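import Literature.NumberTheory.EllipticCurves.IwasawaTowerTorsionProofs
import Literature.NumberTheory.EllipticCurves.SelmerDescentCurrencyProofs
import HarnessLib

/-!
# `E(K)[p] = 0 ⇒ E(K_n)[p] = 0` at every layer of a `ℤ_p`-extension, in Mathlib's `Point` currency of the base change
# `E_{K_n}`; hence `#Sel^(p)(E_{K_n}/K_n) = #Sel_{p^∞}(E_{K_n}/K_n)[p]` at every layer

`Proofs` file (theorems only; no definition, no named fact, no instance, no `sorry`) in topic `NumberTheory/EllipticCurves`.
For an elliptic curve `E/K` over a number field, a prime `p` and ANY `ℤ_p`-extension `κ` with layers `K_n = κ.layer n ⊆ K̄`: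

* `WeierstrassCurve.smul_map_layer_val_eq` — a point of `E(K_n)`, pushed into `E(K̄)` along `K_n ⊆ K̄`
  (`Affine.Point.map (IntermediateField.val (κ.layer n))`), is fixed by `Gal(K̄/K_n) = κ⁻¹(pⁿℤ_p)`;
* ★ `WeierstrassCurve.forall_smul_eq_zero_layer_of_forall_smul_eq_zero` — **if `E(K)` has no point of order `p` then neither has
  `E(K_n)`, for every `n`**: a `K_n`-point `P` with `p • P = 0` maps injectively to a `Gal(K̄/K_n)`-fixed element of `E[p^∞]`, and
  `E[p^∞]^{Gal(K̄/K_n)} = 0` (the pro-`p` fixed-point argument, tree `natCard_fixedBy_layerSubgroup_eq_one`: a `p`-group acting on a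
  non-zero finite `p`-group has a non-zero fixed point, and `E[p^∞]^{Γ_K} ⊆ E(K)[p^∞] = 0`). This is the Galois-theoretic proof; for
  `K = ℚ`, `p = 2` the sibling `SelmerDescentCurrencyProofs` reaches the same conclusion from `3 ∤ [ℚ_n : ℚ]`, which does not
  generalise to odd `p`. The statement is generic in the `DecidableEq` instance of the layer (binder `{instDec}`), so that it feeds
  any consumer's group law on `E(K_n)`;
* ★ `WeierstrassCurve.natCard_selmerGroup_layer_eq_natCard_torsionBy_selmerGroupPInfty` — **`#Sel^(p)(E_{K_n}/K_n) =
  #Sel_{p^∞}(E_{K_n}/K_n)[p]`** at every layer when `E(K)[p] = 0` (the sibling's `…_of_forall` over the number field `K_n`): the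
  `p`-descent over the layer computes exactly the `p`-torsion of the `p^∞`-Selmer group — the DESCENT CURRENCY of cell
  `bsd-f1-sign2`'s road (a), now for every prime and every base field.

Written for cell `bsd-f1-sign2` (crux C2 stmt-BirchSwinnertonDyer-22298, seat `bsd-line-att-p5` gen 45, lineage successor item (iii) of
gen 44). Nothing about BSD or any main conjecture is asserted.

## References

* [GreenbergLNM1716] R. Greenberg, *Iwasawa theory for elliptic curves*, LNM 1716 (1999), §3 proof of Lemma 3.1 (p. 86) and proof of
  Prop. 4.8 (p. 109: a pro-`p` group acting on a non-zero finite `p`-group has non-zero (co)invariants).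
* [SilvermanAEC2009] J. H. Silverman, *The Arithmetic of Elliptic Curves*, 2nd ed., VIII.§1 (Galois action on points), Thm. X.4.2.
* [Washington1997] L. C. Washington, *Introduction to Cyclotomic Fields*, §13.1 (the layers `K_n`).
-/

set_option autoImplicit false

noncomputable section

open scoped Classical AddSubgroup

open Literature.NumberTheory.EllipticCurves Literature.NumberTheory.GaloisRepresentations

universe u

namespace WeierstrassCurve

variable {K : Type u} [Field K] [NumberField K] (W : WeierstrassCurve K) [W.IsElliptic]
  {p : ℕ} [hp : Fact p.Prime] (κ : ZpExtension K p)

omit [NumberField K] [W.IsElliptic] in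
/-- **A `K_n`-rational point is fixed by `Gal(K̄/K_n)`**: for `σ ∈ κ⁻¹(pⁿℤ_p)` and `P ∈ E(K_n)`, `σ` fixes the image of `P` in
`E(K̄)` (its coordinates lie in the fixed field `K_n = K̄^{κ⁻¹(pⁿℤ_p)}`). Generic in the `DecidableEq` instance of the layer.
[cite: SilvermanAEC2009, VIII.§1] [cite: Washington1997, §13.1] -/
theorem smul_map_layer_val_eq (n : ℕ) {instDec : DecidableEq (κ.layer n)} (P : (W.baseChange (κ.layer n)).toAffine.Point)
    {σ : Field.absoluteGaloisGroup K} (hσ : σ ∈ κ.layerSubgroup n) :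
    σ • (show geomPoints W from Affine.Point.map (W' := W) (IntermediateField.val (κ.layer n)) P) =
      (show geomPoints W from Affine.Point.map (W' := W) (IntermediateField.val (κ.layer n)) P) := by
  -- the action is `Affine.Point.map` along the automorphism
  change Affine.Point.map
      ((Field.absoluteGaloisGroup.toAlgEquiv K σ : AlgebraicClosure K ≃ₐ[K] AlgebraicClosure K) :
        AlgebraicClosure K →ₐ[K] AlgebraicClosure K)
      (Affine.Point.map (W' := W) (IntermediateField.val (κ.layer n)) P) =
    Affine.Point.map (W' := W) (IntermediateField.val (κ.layer n)) P
  rw [Affine.Point.map_map]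
  -- `σ` restricted to `K_n` is the inclusion
  have hfix : ∀ x : κ.layer n, Field.absoluteGaloisGroup.toAlgEquiv K σ (x : AlgebraicClosure K) = x := by
    intro x
    have hx : (x : AlgebraicClosure K) ∈ IntermediateField.fixedField
        ((κ.layerSubgroup n).map (Field.absoluteGaloisGroup.toAlgEquiv K).toMonoidHom) := x.2
    rw [IntermediateField.mem_fixedField_iff] at hx
    exact hx _ ⟨σ, hσ, rfl⟩
  have hcomp : ((Field.absoluteGaloisGroup.toAlgEquiv K σ : AlgebraicClosure K ≃ₐ[K] AlgebraicClosure K) :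
        AlgebraicClosure K →ₐ[K] AlgebraicClosure K).comp (IntermediateField.val (κ.layer n)) =
      IntermediateField.val (κ.layer n) := by
    ext x
    exact hfix x
  rw [hcomp]

/-- ★ **`E(K)[p] = 0 ⟹ E(K_n)[p] = 0` at every layer of ANY `ℤ_p`-extension of a number field**, in Mathlib's `Point` currency of
the base change `E_{K_n} = W.baseChange (κ.layer n)` (generic in the `DecidableEq` instance of the layer): a `K_n`-point `P ≠ O` with
`p • P = O` gives a NON-ZERO element of `E[p^∞]^{Gal(K̄/K_n)}` (`Affine.Point.map` along `K_n ⊆ K̄` is injective), but that group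
is trivial when `E(K)` has no point of order `p` (tree `natCard_fixedBy_layerSubgroup_eq_one`: `Γ_K` acts on the finite `p`-group
`E[p^∞]^{Gal(K̄/K_n)}[p]` through the `p`-group `Gal(K_n/K)`, so a non-zero group would have a non-zero `Γ_K`-fixed point, i.e. a
`K`-rational point of order `p`). [cite: GreenbergLNM1716, §3 proof of Lemma 3.1 (p. 86) and Prop. 4.8 (p. 109)] [cite: SilvermanAEC2009, VIII.§1] -/
theorem forall_smul_eq_zero_layer_of_forall_smul_eq_zero (hK : ∀ P : W.toAffine.Point, p • P = 0 → P = 0) (n : ℕ)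
    {instDec : DecidableEq (κ.layer n)} :
    ∀ P : (W.baseChange (κ.layer n)).toAffine.Point, p • P = 0 → P = 0 := by
  intro P hP
  -- `E(K_n) → E(K̄)`
  let ι : (W.baseChange (κ.layer n)).toAffine.Point →+ geomPoints W :=
    Affine.Point.map (W' := W) (IntermediateField.val (κ.layer n))
  have hι : Function.Injective ι := Affine.Point.map_injective (W' := W) _
  by_contra hne
  have hQne : ι P ≠ 0 := fun h ↦ hne (hι (by rw [h, map_zero]))
  have hQp : p • ι P = 0 := by rw [← map_nsmul, hP, map_zero]
  -- `ι P ∈ E[p^∞]`, fixed by `Gal(K̄/K_n)`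
  have hmem : ι P ∈ geomPrimaryTorsion W p :=
    AddCommGroup.mem_primaryComponent.mpr ⟨1, by rw [pow_one]; exact hQp⟩
  have hfix : ∀ σ ∈ κ.layerSubgroup n, σ • (⟨ι P, hmem⟩ : geomPrimaryTorsion W p) = ⟨ι P, hmem⟩ := by
    intro σ hσ
    apply Subtype.ext
    rw [primaryComponent.coe_smul]
    exact W.smul_map_layer_val_eq κ n P hσ
  -- but `E[p^∞]^{Gal(K̄/K_n)}` has exactly one element
  have h1 := W.natCard_fixedBy_layerSubgroup_eq_one κ hK n
  have hsub := (Nat.card_eq_one_iff_unique.mp h1).1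
  have hzero : ∀ σ ∈ κ.layerSubgroup n, σ • (0 : geomPrimaryTorsion W p) = 0 := fun σ _ ↦ smul_zero σ
  have heq := hsub.elim (⟨⟨ι P, hmem⟩, hfix⟩ : {m : geomPrimaryTorsion W p | ∀ σ ∈ κ.layerSubgroup n, σ • m = m})
    ⟨0, hzero⟩
  have : ι P = 0 := by
    have := congrArg (fun m : {m : geomPrimaryTorsion W p | ∀ σ ∈ κ.layerSubgroup n, σ • m = m} ↦
      ((m : geomPrimaryTorsion W p) : geomPoints W)) heq
    simpa using this
  exact hQne this

/-- The `ℤ`-scalar form of the previous statement (`(p : ℤ) • P = 0 → P = 0`), the shape consumed by the descent-currency lemmas of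
`SelmerDescentCurrencyProofs`. [cite: GreenbergLNM1716, §3 proof of Lemma 3.1 (p. 86)] -/
theorem forall_zsmul_eq_zero_layer_of_forall_smul_eq_zero (hK : ∀ P : W.toAffine.Point, p • P = 0 → P = 0) (n : ℕ)
    {instDec : DecidableEq (κ.layer n)} :
    ∀ P : (W.baseChange (κ.layer n)).toAffine.Point, (p : ℤ) • P = 0 → P = 0 :=
  fun P hP ↦ W.forall_smul_eq_zero_layer_of_forall_smul_eq_zero κ hK n P (by rwa [natCast_zsmul] at hP)

/-- ★ **`#Sel^(p)(E_{K_n}/K_n) = #Sel_{p^∞}(E_{K_n}/K_n)[p]` at every layer of ANY `ℤ_p`-extension when `E(K)[p] = 0`** — the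
`p`-Selmer group of a `p`-descent over the number field `K_n` (tree `selmerGroup · p`, Silverman X.4.2) has exactly as many elements as
the `p`-torsion of the `p^∞`-Selmer group over `K_n` (the sibling's `natCard_selmerGroup_eq_natCard_torsionBy_selmerGroupPInfty_of_forall`
over `K_n`, its hypothesis `E(K_n)[p] = 0` supplied by the previous theorem). [cite: SilvermanAEC2009, Thm. X.4.2]
[cite: GreenbergLNM1716, §2 pp. 62–63 and §3 Lemma 3.1] -/
theorem natCard_selmerGroup_layer_eq_natCard_torsionBy_selmerGroupPInfty (hK : ∀ P : W.toAffine.Point, p • P = 0 → P = 0)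
    (n : ℕ) [NumberField (κ.layer n)] :
    Nat.card ((W.baseChange (κ.layer n)).selmerGroup p) =
      Nat.card ((↥((W.baseChange (κ.layer n)).selmerGroupPInfty p))[(p : ℤ)]) :=
  (W.baseChange (κ.layer n)).natCard_selmerGroup_eq_natCard_torsionBy_selmerGroupPInfty_of_forall p
    (W.forall_zsmul_eq_zero_layer_of_forall_smul_eq_zero κ hK n)

end WeierstrassCurve

end
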